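import Literature.Computability.MetaComplexity.GapMINKTNWParams
import HarnessLib

/-!
# Exhaustive search for `MINKT` at exponential time budgets (`t ≥ 2^{|x|}`) is polynomial time

Topic `Literature/Computability/MetaComplexity`. The escape clause of Hirahara's reduction (FOCS 2018 /
ECCC TR18-138, proof of Cor. 4.12: "we may exhaustively search all the descriptions … and check if
`U(d₀)` outputs `x` within time `t`"; proof of Thm. 4.21: "otherwise we have `t₁ ≥ 2ⁿ` … In such a
case, we can exhaustively search all the description in time `poly(t) = 2^{O(n)}`"): when the time
parameter is at least `2^{|x|}`, trying all programs of length `≤ min(s, |x| + C)` costs only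
`2^{C+1} · t` runs of the efficient universal machine, each polynomial in `t`. As a one-bit `FP` function
of the instance `⟨x, ⟨1ᵗ, 1ˢ⟩⟩` (two nested `Brick.allIdxFn` loops over the length `L' ≤ min(s, |x|+C)`
and the value `v < 2^{L'}` of the candidate program `natBits L' v`, around one call of
`GapMINKTDecision.runU`):

* `NWBrute.bfF U C`, `bfF_mem_FP`, **`bfF_apply`** — for `2^{|x|} ≤ t`,
  `bfF ⟨x, 1ᵗ, 1ˢ⟩ = [∃ prog, |prog| ≤ min(s, |x| + C) ∧ U(prog, 1ᵗ) = x]`;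
* `NWBrute.lang U C ∈ P` and `boolPair_mem_lang_iff`.

## References

* S. Hirahara, ECCC TR18-138 (2018), proofs of Cor. 4.12 (p. 19) and Thm. 4.21 (p. 23).
* S. Arora, B. Barak, CUP 2009, §1.3 (bounded loops), Thm. 1.9 (efficient universal machine).
-/

noncomputable section

namespace Literature.Computability.MetaComplexity

open _root_.Computability Polynomial Complexity Complexity.Brick Complexity.Plumb Complexity.OracleCompose Complexity.HashBricks

namespace NWBrute

variable (U : UniversalMachine) (C : ℕ)

/-! ### The records -/

/-- The outer record `⟨inst, 1^{2^C · t}⟩` (the instance and a ruler for the counts `2^{L'}`). [folklore] -/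
def orec (x : List Bool) (t s : ℕ) : List Bool := boolPair (NWPar.inst x t s) (ones (2 ^ C * t))

/-- The outer record as a function of the instance. [folklore] -/
def orecF : List Bool → List Bool := fanoutFn id (umulFn ∘ fanoutFn (fun _ => ones (2 ^ C)) NWPar.TT)

/-- `orecF` re-packs an instance `⟨x, 1ᵗ, 1ˢ⟩` as the search record `orec`. [folklore] -/
theorem orecF_inst (x : List Bool) (t s : ℕ) : orecF C (NWPar.inst x t s) = orec C x t s := by
  simp only [orecF, fanoutFn_apply, id, Function.comp_apply, NWPar.TT_inst, umulFn_boolPair, orec]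

/-- `orecF` is polynomial-time computable (`FP`). [folklore] -/
theorem orecF_mem_FP : orecF C ∈ FP :=
  fanoutFn_mem_FP (PolyTimeComputable.id _) (comp_mem_FP umulFn_mem_FP (fanoutFn_mem_FP (const_mem_FP _) NWPar.TT_mem_FP))

/-- The bound `S = min(s, |x| + C)` in unary, from the outer record: the shorter of `1ˢ` and `1^{|x|+C}`
(`takeFn` of one by the other's length). [folklore] -/
def SF : List Bool → List Bool := takeFn ∘ fanoutFn (NWPar.SS ∘ fstF) (fun w => (NWPar.nF ∘ fstF) w ++ (fun _ => ones C) w)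

/-- The clipped length bound `min s (|x| + C)` read off the search record. [folklore] -/
theorem SF_orec (x : List Bool) (t s : ℕ) : SF C (orec C x t s) = ones (min s (x.length + C)) := by
  simp only [SF, Function.comp_apply, fanoutFn_apply, orec, fstF_boolPair, NWPar.SS_inst, NWPar.nF_inst, takeFn_boolPair, ones,
    List.replicate_append_replicate, List.length_replicate, List.take_replicate]

/-- `SF` is polynomial-time computable (`FP`). [folklore] -/
theorem SF_mem_FP : SF C ∈ FP :=
  comp_mem_FP takeFn_mem_FP (fanoutFn_mem_FP (comp_mem_FP NWPar.SS_mem_FP fstF_mem_FP)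
    (append_mem_FP (comp_mem_FP NWPar.nF_mem_FP fstF_mem_FP) (const_mem_FP _)))

/-! ### The candidate program and its run -/

/-- On `⟨⟨orec, 1^{L'}⟩, 1ᵛ⟩`: the candidate program `natBits L' v`. [folklore] -/
def progF : List Bool → List Bool :=
  takeFn ∘ fanoutFn (sndF ∘ fstF) (fun w => (lenBinF ∘ sndF) w ++ (Kannan.zerosFn ∘ sndF ∘ fstF) w)

/-- `progF` extracts the candidate program from an indexed search record. [folklore] -/
theorem progF_apply (x : List Bool) (t s L' v : ℕ) :
    progF (boolPair (boolPair (orec C x t s) (ones L')) (ones v)) = (encodeNat v ++ List.replicate L' false).take L' := by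
  simp only [progF, Function.comp_apply, fanoutFn_apply, fstF_boolPair, sndF_boolPair, lenBinF_apply, Kannan.zerosFn_apply, List.length_replicate,
    takeFn_boolPair]

/-- `progF` is polynomial-time computable (`FP`). [folklore] -/
theorem progF_mem_FP : progF ∈ FP :=
  comp_mem_FP takeFn_mem_FP (fanoutFn_mem_FP (comp_mem_FP sndF_mem_FP fstF_mem_FP)
    (append_mem_FP (comp_mem_FP lenBinF_mem_FP sndF_mem_FP) (comp_mem_FP Kannan.zerosFn_mem_FP (comp_mem_FP sndF_mem_FP fstF_mem_FP))))

/-- On `⟨⟨orec, 1^{L'}⟩, 1ᵛ⟩`: `[U(prog, 1ᵗ) ≠ x]` (the run through `GapMINKTDecision.runU`, compared with `1 x`).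
[cite: Hirahara2018, Cor. 4.12 (proof: "check if `U(d₀)` outputs `x` within time `t`")] -/
def failF : List Bool → List Bool :=
  notFn (eqPairFn ∘ fanoutFn (GapMINKTDecision.runU U ∘ fanoutFn progF (NWPar.TT ∘ fstF ∘ fstF ∘ fstF))
    (fun w => (fun _ => [true]) w ++ (fstF ∘ fstF ∘ fstF ∘ fstF) w))

/-- `failF` outputs one bit. [folklore] -/
theorem oneBit_failF : OneBit (failF U) := oneBit_notFn fun w => by
  simp only [Function.comp_apply, fanoutFn_apply]
  exact ⟨_, eqPairFn_boolPair _ _⟩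

/-- `failF` tests whether the candidate program fails to print `x` within `t` steps. [folklore] -/
theorem failF_apply (x : List Bool) (t s L' v : ℕ) :
    failF U (boolPair (boolPair (orec C x t s) (ones L')) (ones v)) =
      [decide (U.run ((encodeNat v ++ List.replicate L' false).take L') t ≠ some x)] := by
  rw [failF, notFn_apply (b := decide (U.run ((encodeNat v ++ List.replicate L' false).take L') t = some x))]
  · simp
  · simp only [Function.comp_apply, fanoutFn_apply, progF_apply]
    simp only [fstF_boolPair, orec, NWPar.TT_inst, NWPar.fstF_inst, GapMINKTDecision.runU_boolPair, List.length_replicate, eqPairFn_boolPair,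
      List.singleton_append]
    congr 1
    rw [decide_eq_decide]
    cases h : U.run ((encodeNat v ++ List.replicate L' false).take L') t <;> simp

/-- `failF` is polynomial-time computable (`FP`). [folklore] -/
theorem failF_mem_FP : failF U ∈ FP := by
  have h3 : (fstF ∘ fstF ∘ fstF : List Bool → List Bool) ∈ FP := comp_mem_FP fstF_mem_FP (comp_mem_FP fstF_mem_FP fstF_mem_FP)
  exact notFn_mem_FP (comp_mem_FP eqPairFn_mem_FP (fanoutFn_mem_FP
    (comp_mem_FP (GapMINKTDecision.runU_mem_FP U) (fanoutFn_mem_FP progF_mem_FP (comp_mem_FP NWPar.TT_mem_FP h3)))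
    (append_mem_FP (const_mem_FP _) (comp_mem_FP fstF_mem_FP h3))))

/-! ### The two loops -/

/-- On `⟨orec, 1^{L'}⟩`: `[no program of length L' works]`, the index-all loop over `v < 2^{L'}` (the count
from the ruler). [cite: Hirahara2018, Thm. 4.21 (proof: "exhaustively search all the description")] -/
def noneLenF : List Bool → List Bool := allIdxFn (NWRec.pow2F ∘ fanoutFn (sndF ∘ fstF) sndF) (failF U)

/-- `noneLenF` on an indexed record: no program of the given length prints `x` in `t` steps. [folklore] -/
theorem noneLenF_apply {x : List Bool} {t s L' : ℕ} (hL : 2 ^ L' ≤ 2 ^ C * t) :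
    noneLenF U (boolPair (orec C x t s) (ones L')) = [decide (∀ v < 2 ^ L', U.run ((encodeNat v ++ List.replicate L' false).take L') t ≠ some x)] := by
  have hy : (NWRec.pow2F ∘ fanoutFn (sndF ∘ fstF) sndF) (boolPair (orec C x t s) (ones L')) = ones (2 ^ L') := by
    simp only [Function.comp_apply, fanoutFn_apply, fstF_boolPair, sndF_boolPair, orec, NWRec.pow2F_apply, List.length_replicate, min_eq_left hL]
  rw [noneLenF, allIdxFn_apply (oneBit_failF U) (by rw [hy, length_boolPair, orec, length_boolPair]; simp only [List.length_replicate]; omega), hy]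
  simp only [List.length_replicate, failF_apply, List.cons.injEq, and_true, decide_eq_true_eq]

/-- `noneLenF` is polynomial-time computable (`FP`). [folklore] -/
theorem noneLenF_mem_FP : noneLenF U ∈ FP :=
  allIdxFn_mem_FP (comp_mem_FP NWRec.pow2F_mem_FP (fanoutFn_mem_FP (comp_mem_FP sndF_mem_FP fstF_mem_FP) sndF_mem_FP)) (failF_mem_FP U) (oneBit_failF U)

/-- The count yardstick never exceeds the record (so the inner loop is one-bit on every input). [folklore] -/
theorem length_pow2F_le (w : List Bool) : (NWRec.pow2F w).length ≤ (fstF w).length := by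
  rw [NWRec.pow2F, Function.comp_apply, fanoutFn_apply, binToUnaryFn_boolPair]
  simp only [List.length_replicate]
  exact min_le_right _ _

/-- `noneLenF U` is one-bit on every input. [folklore] -/
theorem oneBit_noneLenF : OneBit (noneLenF U) :=
  oneBit_allIdxFn (oneBit_failF U) fun u => by
    refine (length_pow2F_le _).trans ?_
    rw [fanoutFn_apply, fstF_boolPair, Function.comp_apply]
    have h1 := length_fstF_sndF_le u
    have h2 := length_fstF_sndF_le (fstF u)
    omega

/-- **The exhaustive search** on the instance: `[∃ L' ≤ S, some program of length L' works]`, `S = min(s, |x|+C)`.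
[cite: Hirahara2018, Thm. 4.21 (proof)] -/
def bfF : List Bool → List Bool := notFn (allIdxFn (fun w => SF C w ++ (fun _ => [true]) w) (noneLenF U)) ∘ orecF C

/-- **`bfF U C ∈ FP`.** [cite: Hirahara2018, Thm. 4.21 (proof: "in time `poly(t) = 2^{O(n)}`")] -/
theorem bfF_mem_FP : bfF U C ∈ FP :=
  comp_mem_FP (notFn_mem_FP (allIdxFn_mem_FP (append_mem_FP (SF_mem_FP C) (const_mem_FP _)) (noneLenF_mem_FP U) (oneBit_noneLenF U))) (orecF_mem_FP C)

/-- Padding a numeral and reading it back. [folklore] -/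
theorem take_encodeNat_bitsToNat (prog : List Bool) :
    (encodeNat (bitsToNat prog) ++ List.replicate prog.length false).take prog.length = prog := by
  rw [NWRec.take_encodeNat_append_replicate (bitsToNat_lt prog)]
  exact CoinEnum.natBits_bitsToNat prog

open Classical in
/-- **Value of the exhaustive search** (for `2^{|x|} ≤ t`): some program of length `≤ min(s, |x| + C)` prints `x`
within `t` steps. [cite: Hirahara2018, Thm. 4.21 (proof)] -/
theorem bfF_apply {x : List Bool} {t s : ℕ} (ht : 2 ^ x.length ≤ t) :
    bfF U C (NWPar.inst x t s) = [decide (∃ prog : List Bool, prog.length ≤ min s (x.length + C) ∧ U.run prog t = some x)] := by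
  set S := min s (x.length + C) with hS
  have hpow : ∀ L' ≤ S, 2 ^ L' ≤ 2 ^ C * t := fun L' hL' =>
    calc 2 ^ L' ≤ 2 ^ (x.length + C) := Nat.pow_le_pow_right (by norm_num) (hL'.trans (min_le_right _ _))
      _ = 2 ^ C * 2 ^ x.length := by rw [pow_add, mul_comm]
      _ ≤ 2 ^ C * t := Nat.mul_le_mul_left _ ht
  have hyard : (SF C (orec C x t s) ++ (fun _ => [true]) (orec C x t s)).length ≤ (orec C x t s).length := by
    rw [SF_orec, List.length_append, List.length_singleton, orec, length_boolPair, NWPar.inst, length_boolPair, length_boolPair]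
    simp only [List.length_replicate]; omega
  rw [bfF, Function.comp_apply, orecF_inst, notFn_apply (allIdxFn_apply (oneBit_noneLenF U) hyard), SF_orec]
  simp only [List.length_append, List.length_replicate, List.length_singleton, ← hS]
  congr 1
  have hP : (∀ L' < S + 1, noneLenF U (boolPair (orec C x t s) (ones L')) = [true]) ↔
      ∀ L' ≤ S, ∀ v < 2 ^ L', U.run ((encodeNat v ++ List.replicate L' false).take L') t ≠ some x := by
    refine ⟨fun h L' hL' => ?_, fun h L' hL' => ?_⟩
    · have := h L' (Nat.lt_succ_of_le hL')
      rw [noneLenF_apply U C (hpow L' hL')] at this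
      simpa using this
    · rw [noneLenF_apply U C (hpow L' (Nat.le_of_lt_succ hL'))]
      simpa using h L' (Nat.le_of_lt_succ hL')
  rw [← decide_not, decide_eq_decide, hP]
  push Not
  constructor
  · rintro ⟨L', hL', v, -, hrun⟩
    refine ⟨_, ?_, hrun⟩
    rw [List.length_take, List.length_append, List.length_replicate]
    omega
  · rintro ⟨prog, hlen, hrun⟩
    exact ⟨prog.length, hlen, bitsToNat prog, bitsToNat_lt prog, by rwa [take_encodeNat_bitsToNat]⟩

/-- **The language of the exhaustive search** and its membership in `P`. [cite: Hirahara2018, Thm. 4.21 (proof)] -/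
def lang : Language Bool := {w | bfF U C w = [true]}

/-- `lang U C ∈ P`. [cite: Hirahara2018, Thm. 4.21 (proof: "in time `poly(t)`")] -/
theorem lang_mem_P : lang U C ∈ Classes.P := setOf_apply_eq_apply_mem_P (bfF_mem_FP U C) (const_mem_FP [true])

/-- Membership on genuine instances with `2^{|x|} ≤ t`. [cite: Hirahara2018, Thm. 4.21 (proof)] -/
theorem inst_mem_lang_iff {x : List Bool} {t s : ℕ} (ht : 2 ^ x.length ≤ t) :
    NWPar.inst x t s ∈ lang U C ↔ ∃ prog : List Bool, prog.length ≤ min s (x.length + C) ∧ U.run prog t = some x := by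
  classical
  change bfF U C (NWPar.inst x t s) = [true] ↔ _
  rw [bfF_apply U C ht]
  simp

end NWBrute


end Literature.Computability.MetaComplexity

end
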